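import Summits.ABC.IUTFork.LDHGenuineStepVSum
import Summits.ABC.IUTFork.LDHGenuineStepVPoint
import Literature.IUT.LogVolume.GenuineLogThetaTowerArith
import Literature.IUT.LogVolume.GenuineSupportPrimesBoundPinned
import Literature.IUT.LogVolume.Theorem110GenuineStepIIAtDatum
import Literature.IUT.LogVolume.GenuineLogThetaPointGalois
import Literature.IUT.LogVolume.DifferentOrdGaloisFibre
import HarnessLib

/-!
# The fork at [IUTchIII] Corollary 3.12, L-DH level: S-b (TOWER ARITHMETIC) AT THE GENUINE DATUM with the
# classical tower facts DISCHARGED — `HullEstimateOf T (B_III P l)` modulo only the (R4) e-term and the regime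

Record-only file (D-0012) of the abc-iut cell (campaign-S seat abc-iut-S3, S-b holder for the crux `ThetaPartII`,
stmt-ABC-19678; layer-2 lines «display (U)» v1.2 and «display-P»); TAKES NO SIDE on [IUTchIII] Cor. 3.12 or on the
reading (U)/(P) of `−|log(Θ)|`. Mochizuki, *Inter-universal Teichmüller theory IV* (RIMS manuscript Apr. 2020), Thm. 1.10
proof Steps (ii) p. 24, (iii) pp. 25–26, (v) pp. 27–29.

`LDHGenuineTowerArith.lean` (abc-iut-S3) reduced the log-volume stub's body `T.HullEstimateOf (B_III P l)` to a bundle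
`H` of tower facts (α) Galois/degrees, (β) Prop. 1.8 (vi)(vii) instance forms, (γ) the (R4) e-term, (δ) slot-constancy.
Within the hour (α) and (β) became THEOREMS for every datum of the cell's reading v3: abc-iut-S2's
`ThetaVolumeDatumAt.isGalois_fieldOfModuli_K` / `isGalois_tpd` / `isGalois_F_K` (`GenuineLogThetaPointGalois`), abc-iut-S-d1's
`ThetaVolumeDatumAt.ndeg_differentDivisor_le` (`Theorem110GenuineStepIIAtDatum`: `log(𝔡^K) ≤ log-diff + log 𝔣 + 2·log l +
21`, every hypothesis discharged) and — through them — abc-iut-S3's `sum_log_supportPrimes_le_pinned`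
(`GenuineSupportPrimesBoundPinned`). THIS FILE re-assembles S-b on these:

* `PointDict.deltaExplicit_le_BIII_pinned (T) (hP : P ∈ UP) (h7 : 7 ≤ l)` — the explicit Step (v) constant of the datum
  (common currency of abc-iut-c312-d1 (U) / abc-iut-S7 (P)) is `≤ B_III(P, l)`, with NO further hypothesis;
* `PointDict.hullEstimateOf_BIII_pinned (T) (hP) (h7) (hR4) (hconst)` — (U) reading: `T.HullEstimateOf (B_III P l)` modulo
  the (R4) e-term input (γ) (abc-iut-S1's lane: `R4_localFieldFamily_of_ramificationIdx_le` ∘ the two-root inertia lemma,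
  `e_mod := d_mod`) and slot-constancy (δ) (the regime; abc-iut-c312-d1);
* `PointDict.hullEstimateOf_BIII_pinned_of_dmod_eq_one (T) (hP) (h7) (hd : d_mod = 1) (hR4)` — (δ) discharged at
  degree-one points (abc-iut-c312-d1 `PointStepV.slotConstant_of_dmod_eq_one`);
* the `∀ T` form `hullVolumeAtDatum_BIII_pinned_of_dmod_eq_one`; the per-image (P) twins
  (`hullEstimatePerImageOf_BIII_pinned`, modulo (γ) ONLY) are in `LDHGenuineTowerArithPinnedP.lean`;
* `PointDict.r4_of_iotaForm` — abc-iut-S1's `ι`-form of the (R4) e-term ("`3 + log e ≤ 4·[p ≤ N]·L`") implies the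
  `N`-form consumed here ("`p ≤ N ∧ 3 + log e ≤ 4·L`").
(abc-iut-S-d1's staged `LDHGenuineTowerFactsGlue` reaches the same (U) conclusion through the H-bundle junction
`hullEstimateOf_BIII_of_towerFacts` + `ThetaVolumeDatumAt.towerFacts`; this file takes the direct route and adds the
(P) and degree-one forms.)

So, on the volume side of the crux, what stands between the tree and the registered stubs (ii′)/(ii′-P) at an admissible
`(P, l)` is: (γ) the (R4) e-term at the datum — and, in reading (U) at `d_mod > 1`, the slot-constant regime (= VERDICT
RISK 7's locus). [cite: Mochizuki2012, IUTchIV Thm. 1.10 proof Steps (ii)–(v) p. 24–29] [claim: Mochizuki2012, status: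
disputed] for every IUT quotation. Nothing here asserts (γ), (δ), Cor. 3.12 or a reading of it for any point.
-/

noncomputable section

namespace Summit.ABC.IUTFork

open Literature.IUT.HodgeTheaters Literature.IUT.LogVolume NumberField IsDedekindDomain
open Literature.NumberTheory.DiophantineGeometry.GenEll
open scoped Nat.Prime

namespace PointDict

variable {P : NFPoint} {l : ℕ}

/-- `log((2^12·3^3·5·d)·l) ≥ 0` for `d, l ≥ 1`. [cite: Mochizuki2012, IUTchIV Thm. 1.10 p. 22] -/
private theorem log_dstar_mul_nonneg'' {d l : ℕ} (hd : 1 ≤ d) (hl : 1 ≤ l) :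
    0 ≤ Real.log (((2 ^ 12 * 3 ^ 3 * 5 * d : ℕ) : ℝ) * l) := by
  apply Real.log_nonneg
  have h1 : (1 : ℝ) ≤ ((2 ^ 12 * 3 ^ 3 * 5 * d : ℕ) : ℝ) := by exact_mod_cast (by nlinarith : 1 ≤ 2 ^ 12 * 3 ^ 3 * 5 * d)
  have h2 : (1 : ℝ) ≤ (l : ℝ) := by exact_mod_cast hl
  nlinarith

/-- **The `ι`-form of (R4) implies the `N`-form.** For a genuine input `I`, a threshold `N` and a size `L`: if at every
support prime `p` and place `v | p`, `p − 2 < e(K_{v̲}) ⟹ 3 + log e(K_{v̲}) ≤ 4·[p ≤ N]·L` (abc-iut-S1's shape,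
`PlaceSection.R4_localFieldFamily_abs` / `…_of_ramificationIdx_le`), then `p − 2 < e(K_{v̲}) ⟹ p ≤ N ∧ 3 + log e(K_{v̲}) ≤
4·L` (abc-iut-c312-d1's `hR4` shape, the one consumed below): for `p > N` the premise would give `3 + log e ≤ 0 < 3`.
[cite: Mochizuki2012, IUTchIV Thm. 1.10 proof Step (iii) (R4) p. 26] -/
theorem r4_of_iotaForm {F₀ K : Type} [Field F₀] [NumberField F₀] [Field K] [NumberField K] [Algebra F₀ K]
    (I : ThetaVolumeInput F₀ K) {N : ℕ} {L : ℝ}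
    (h : ∀ (p : ℕ) [hp : Fact p.Prime], p ∈ I.supportPrimes → ∀ v : placesOver F₀ p,
      p - 2 < absRamificationIdx p ((I.σ.localFieldFamily p hp.out).k v) →
        3 + Real.log (absRamificationIdx p ((I.σ.localFieldFamily p hp.out).k v)) ≤
          4 * (if p ≤ N then (1 : ℝ) else 0) * L) :
    ∀ (p : ℕ) [hp : Fact p.Prime], p ∈ I.supportPrimes → ∀ v : placesOver F₀ p,
      p - 2 < absRamificationIdx p ((I.σ.localFieldFamily p hp.out).k v) →
        p ≤ N ∧ 3 + Real.log (absRamificationIdx p ((I.σ.localFieldFamily p hp.out).k v)) ≤ 4 * L := by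
  intro p hp hpT v hlt
  have h' := h p hpT v hlt
  by_cases hpN : p ≤ N
  · rw [if_pos hpN, mul_one] at h'
    exact ⟨hpN, h'⟩
  · exfalso
    rw [if_neg hpN, mul_zero, zero_mul] at h'
    have h0 : 0 ≤ Real.log (absRamificationIdx p ((I.σ.localFieldFamily p hp.out).k v) : ℝ) :=
      Real.log_natCast_nonneg _
    linarith

/-- **The explicit Step (v) constant of a genuine datum is at most `B_III(P, l)` — classical tower facts discharged.**
For every genuine Θ-volume datum `T` at `(P, l)` with `λ ∈ U_X` (minimally presented) and `l ≥ 7`: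
`(l+1)/4·{(1+4/l)·A(T) + (4/l)·B(T) + (20/3)·log(d*·l)·C(T)} ≤ B_III(P, l)`, where `A(T)` is the `T(I)`-restricted
different sum over the section's places (≤ `log 𝔡^K`, abc-iut-S1, `K/F_mod` Galois by abc-iut-S2), bounded by
`log-diff + log 𝔣 + 2·log l + 21` (abc-iut-S-d1 `ThetaVolumeDatumAt.ndeg_differentDivisor_le`); `B(T) = Σ_{p∈T(I)} log p`
(abc-iut-S3 `sum_log_supportPrimes_le_pinned`); `C(T) = #{p ∈ T(I) : p ≤ d*·l} ≤ π(d*·l)`; then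
`Cor22.deltaK_le_BIII_of_le21`. [cite: Mochizuki2012, IUTchIV Thm. 1.10 proof Steps (ii)–(v) p. 24–29]
[claim: Mochizuki2012, status: disputed] -/
theorem deltaExplicit_le_BIII_pinned (T : Cor22.ThetaVolumeDatumAt P l) (hP : P ∈ UP) (h7 : 7 ≤ l) :
    (letI := T.instFieldF; letI := T.instNumberFieldF; letI := T.instAlgebraF; letI := T.instFieldK
     letI := T.instNumberFieldK; letI := T.instAlgebraK; letI := T.instIsElliptic
     ((l : ℝ) + 1) / 4 * ((1 + 4 / (l : ℝ)) *
          (∑ p ∈ T.I.supportPrimes, if hp : p.Prime then haveI : Fact p.Prime := ⟨hp⟩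
            (∑ v : placesOver (fieldOfModuli T.E) p, (localDegree (fieldOfModuli T.E) v.1 : ℝ) *
              differentOrd p ((T.I.σ.localFieldFamily p hp).k v)) / Module.finrank ℚ (fieldOfModuli T.E) * Real.log p
            else 0)
        + 4 / (l : ℝ) * (∑ p ∈ T.I.supportPrimes, Real.log p)
        + 20 / 3 * Real.log (((2 ^ 12 * 3 ^ 3 * 5 * Cor22.dmod P : ℕ) : ℝ) * l)
          * ((T.I.supportPrimes.filter (· ≤ 2 ^ 12 * 3 ^ 3 * 5 * Cor22.dmod P * l)).card : ℝ))) ≤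
      ((l : ℝ) + 1) / 4 * ((1 + 12 * (Cor22.dmod P : ℝ) / l) * (P.logDiff + Cor22.logCondAvoid P {2, l})
        + 2 * Real.log l + 52 + 20 / 3 * Real.log (((2 ^ 12 * 3 ^ 3 * 5 * Cor22.dmod P : ℕ) : ℝ) * (l : ℝ))
          * (Nat.primeCounting (2 ^ 12 * 3 ^ 3 * 5 * Cor22.dmod P * l) : ℝ)) := by
  classical
  letI := T.instFieldF; letI := T.instNumberFieldF; letI := T.instAlgebraF; letI := T.instFieldK
  letI := T.instNumberFieldK; letI := T.instAlgebraK; letI := T.instFieldFbar; letI := T.instAlgebraFbar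
  letI := T.instAlgebraKFbar; letI := T.instIsElliptic
  have hU : P.InU := hP.1
  have hl : l.Prime := T.D.l_prime
  have h5 : 5 ≤ l := by omega
  have hd : 1 ≤ Cor22.dmod P := Cor22.dmod_pos P
  haveI : IsGalois (fieldOfModuli T.E) T.K := T.isGalois_fieldOfModuli_K
  have hprimes : ∀ p ∈ T.I.supportPrimes, p.Prime := fun p hp => T.I.prime_of_mem_supportPrimes hp
  -- `A ≤ log 𝔡^K ≤ log-diff + log 𝔣 + 2·log l + 21`
  have hA1 := sum_dite_localDegree_mul_differentOrd_le_ndeg (fieldOfModuli T.E) T.K T.I.σ T.I.supportPrimes hprimes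
  have hA2 := T.ndeg_differentDivisor_le hU h7
  have hA : (∑ p ∈ T.I.supportPrimes, if hp : p.Prime then haveI : Fact p.Prime := ⟨hp⟩
        (∑ v : placesOver (fieldOfModuli T.E) p, (localDegree (fieldOfModuli T.E) v.1 : ℝ) *
          differentOrd p ((T.I.σ.localFieldFamily p hp).k v)) / Module.finrank ℚ (fieldOfModuli T.E) * Real.log p
        else 0) ≤ P.logDiff + Cor22.logCondAvoid P {2, l} + 2 * Real.log l + 21 := hA1.trans hA2
  -- `B ≤ 2·d_mod·(log-diff + log 𝔣) + log(30·l)`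
  have hB := T.sum_log_supportPrimes_le_pinned hP
  -- `C ≤ π(d*·l)`
  have hC : (((T.I.supportPrimes.filter (· ≤ 2 ^ 12 * 3 ^ 3 * 5 * Cor22.dmod P * l)).card : ℕ) : ℝ) ≤
      (π (2 ^ 12 * 3 ^ 3 * 5 * Cor22.dmod P * l) : ℝ) := by
    exact_mod_cast Cor22.card_filter_le_primeCounting T.I.supportPrimes hprimes _
  have hδ := Cor22.deltaK_le_BIII_of_le21 (P := P) hl h5 hd le_rfl hA hB hC
  refine le_trans (le_of_eq ?_) hδ
  have e : (((2 ^ 12 * 3 ^ 3 * 5 * Cor22.dmod P : ℕ) : ℝ) * l) = ((2 : ℝ) ^ 12 * 3 ^ 3 * 5 * (Cor22.dmod P) * l) := by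
    push_cast; ring
  rw [e]

/-- **S-b AT THE DATUM, reading (U): `T.HullEstimateOf (B_III P l)` modulo the (R4) e-term and slot-constancy only.**
abc-iut-c312-d1's `hullEstimateOf_ofInput_explicit` (S-a, slot-constant regime) composed with `deltaExplicit_le_BIII_pinned`.
[cite: Mochizuki2012, IUTchIV Thm. 1.10 proof Steps (ii)–(v) p. 24–29] [claim: Mochizuki2012, status: disputed] -/
theorem hullEstimateOf_BIII_pinned (T : Cor22.ThetaVolumeDatumAt P l) (hP : P ∈ UP) (h7 : 7 ≤ l)
    (hR4 : letI := T.instFieldF; letI := T.instNumberFieldF; letI := T.instFieldK; letI := T.instNumberFieldK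
      letI := T.instAlgebraK; letI := T.instIsElliptic
      ∀ (p : ℕ) [hp : Fact p.Prime], p ∈ T.I.supportPrimes → ∀ v : placesOver (fieldOfModuli T.E) p,
        p - 2 < absRamificationIdx p ((T.I.σ.localFieldFamily p hp.out).k v) →
          p ≤ 2 ^ 12 * 3 ^ 3 * 5 * Cor22.dmod P * l ∧
            3 + Real.log (absRamificationIdx p ((T.I.σ.localFieldFamily p hp.out).k v)) ≤
              4 * Real.log (((2 ^ 12 * 3 ^ 3 * 5 * Cor22.dmod P : ℕ) : ℝ) * l))
    (hconst : letI := T.instFieldF; letI := T.instNumberFieldF; letI := T.instFieldK; letI := T.instNumberFieldK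
      letI := T.instAlgebraK; letI := T.instIsElliptic
      ∀ p ∈ T.I.supportPrimes, ∀ v w : placesOver (fieldOfModuli T.E) p,
        (DHData.ofInput T.I).logQloc p v = (DHData.ofInput T.I).logQloc p w) :
    T.HullEstimateOf (((l : ℝ) + 1) / 4 * ((1 + 12 * (Cor22.dmod P : ℝ) / l) * (P.logDiff + Cor22.logCondAvoid P {2, l})
      + 2 * Real.log l + 52 + 20 / 3 * Real.log (((2 ^ 12 * 3 ^ 3 * 5 * Cor22.dmod P : ℕ) : ℝ) * (l : ℝ))
        * (Nat.primeCounting (2 ^ 12 * 3 ^ 3 * 5 * Cor22.dmod P * l) : ℝ))) := by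
  classical
  letI := T.instFieldF; letI := T.instNumberFieldF; letI := T.instAlgebraF; letI := T.instFieldK
  letI := T.instNumberFieldK; letI := T.instAlgebraK; letI := T.instFieldFbar; letI := T.instAlgebraFbar
  letI := T.instAlgebraKFbar; letI := T.instIsElliptic
  have hl1 : 1 ≤ l := by omega
  have hd : 1 ≤ Cor22.dmod P := Cor22.dmod_pos P
  have hXl : ((T.I.X.l : ℕ) : ℝ) = (l : ℝ) := by exact_mod_cast T.isVolumeInputOf.l_eq
  have h0 := DHData.hullEstimateOf_ofInput_explicit T.I (2 ^ 12 * 3 ^ 3 * 5 * Cor22.dmod P * l)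
    (log_dstar_mul_nonneg'' hd hl1) hR4 hconst
  rw [hXl] at h0
  exact T.hullEstimateOf_mono h0 (deltaExplicit_le_BIII_pinned T hP h7)

/-- **At a `d_mod = 1` point, reading (U): `T.HullEstimateOf (B_III P l)` modulo the (R4) e-term ONLY** (slot-constancy
is automatic: one place of `F_mod = ℚ` over each prime, abc-iut-c312-d1 `PointStepV.slotConstant_of_dmod_eq_one`).
[cite: Mochizuki2012, IUTchIV Thm. 1.10 proof Steps (ii)–(v) p. 24–29] [claim: Mochizuki2012, status: disputed] -/
theorem hullEstimateOf_BIII_pinned_of_dmod_eq_one (T : Cor22.ThetaVolumeDatumAt P l) (hP : P ∈ UP) (h7 : 7 ≤ l)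
    (hd : Cor22.dmod P = 1)
    (hR4 : letI := T.instFieldF; letI := T.instNumberFieldF; letI := T.instFieldK; letI := T.instNumberFieldK
      letI := T.instAlgebraK; letI := T.instIsElliptic
      ∀ (p : ℕ) [hp : Fact p.Prime], p ∈ T.I.supportPrimes → ∀ v : placesOver (fieldOfModuli T.E) p,
        p - 2 < absRamificationIdx p ((T.I.σ.localFieldFamily p hp.out).k v) →
          p ≤ 2 ^ 12 * 3 ^ 3 * 5 * Cor22.dmod P * l ∧
            3 + Real.log (absRamificationIdx p ((T.I.σ.localFieldFamily p hp.out).k v)) ≤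
              4 * Real.log (((2 ^ 12 * 3 ^ 3 * 5 * Cor22.dmod P : ℕ) : ℝ) * l)) :
    T.HullEstimateOf (((l : ℝ) + 1) / 4 * ((1 + 12 * (Cor22.dmod P : ℝ) / l) * (P.logDiff + Cor22.logCondAvoid P {2, l})
      + 2 * Real.log l + 52 + 20 / 3 * Real.log (((2 ^ 12 * 3 ^ 3 * 5 * Cor22.dmod P : ℕ) : ℝ) * (l : ℝ))
        * (Nat.primeCounting (2 ^ 12 * 3 ^ 3 * 5 * Cor22.dmod P * l) : ℝ))) :=
  hullEstimateOf_BIII_pinned T hP h7 hR4 (PointStepV.slotConstant_of_dmod_eq_one T hd)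

/-- **`Cor22.HullVolumeAtDatum P l (B_III P l)` at a `d_mod = 1` point modulo the (R4) e-term at every datum** (the `∀ T`
form, reading (U)). [cite: Mochizuki2012, IUTchIV Thm. 1.10 proof Steps (ii)–(v) p. 24–29] [claim: Mochizuki2012, status: disputed] -/
theorem hullVolumeAtDatum_BIII_pinned_of_dmod_eq_one (hP : P ∈ UP) (h7 : 7 ≤ l) (hd : Cor22.dmod P = 1)
    (hR4 : ∀ T : Cor22.ThetaVolumeDatumAt P l,
      letI := T.instFieldF; letI := T.instNumberFieldF; letI := T.instFieldK; letI := T.instNumberFieldK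
      letI := T.instAlgebraK; letI := T.instIsElliptic
      ∀ (p : ℕ) [hp : Fact p.Prime], p ∈ T.I.supportPrimes → ∀ v : placesOver (fieldOfModuli T.E) p,
        p - 2 < absRamificationIdx p ((T.I.σ.localFieldFamily p hp.out).k v) →
          p ≤ 2 ^ 12 * 3 ^ 3 * 5 * Cor22.dmod P * l ∧
            3 + Real.log (absRamificationIdx p ((T.I.σ.localFieldFamily p hp.out).k v)) ≤
              4 * Real.log (((2 ^ 12 * 3 ^ 3 * 5 * Cor22.dmod P : ℕ) : ℝ) * l)) :
    Cor22.HullVolumeAtDatum P l (((l : ℝ) + 1) / 4 * ((1 + 12 * (Cor22.dmod P : ℝ) / l)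
      * (P.logDiff + Cor22.logCondAvoid P {2, l}) + 2 * Real.log l + 52
        + 20 / 3 * Real.log (((2 ^ 12 * 3 ^ 3 * 5 * Cor22.dmod P : ℕ) : ℝ) * (l : ℝ))
          * (Nat.primeCounting (2 ^ 12 * 3 ^ 3 * 5 * Cor22.dmod P * l) : ℝ))) :=
  fun T => hullEstimateOf_BIII_pinned_of_dmod_eq_one T hP h7 hd (hR4 T)

end PointDict

end Summit.ABC.IUTFork

end
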